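import Mathlib
import HarnessLib

/-!
# Zhang (2022), §5, proof of Lemma 5.3: the phase `s₀w − 𝓛₂²w² − 2πix(e^w − 1)` of (5.10) —
# the factorisation `f*`, (5.13) EXACT, and every displayed pointwise estimate on the contours
# `L₁,…,L₅` and `L′₁, L′₂, L′₃`, kernel-checked

Topic `Literature/NumberTheory/LFunctions/Zhang2022` (Landau–Siegel autopsy tree; verdict-neutral).
Y. Zhang, *Discrete mean estimates and the Landau–Siegel zero*, arXiv:2211.02515v1 (2022) — **an
unrefereed manuscript, a claimed result under adjudication** (cell pub-zhang: audit + repair census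
of arXiv:2211.02515; no claim about Landau–Siegel).

Glossary: the source macro `\l` is `𝓛 = log D` ((2.1)); `𝓛₂ = 𝓛^{400}` ((2.15)); `s₀ = 1/2 + 2πit₀`;
`α` is (2.7); `ε = exp{−c𝓛^{10}}` (§4). Here `𝓛₂`, `t₀`, `x` are free real parameters `L₂`, `t₀`,
`x`; `w = u + iv`. The manuscript's values and ranges (`u* = 𝓛₂^{−1}𝓛⁵`, `v* = π(t₀−x)/𝓛₂²`,
`x ≤ t₀^{1.02}` / `x > t₀^{1.02}`, the constant `10^{−2}`, `x^{0.99}`) enter only as hypotheses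
of the shape actually used (`X ≤ xe^u`, `2t₀ < X`, `u ≤ −c·log x`, …).

Source text, §5 p. 10–11 (proof of Lemma 5.3), the displays reproduced here:

> `Δ(x) = ∫_{−∞}^{∞} exp{s₀u − 𝓛₂²u² − 2πix(e^u − 1)} du.`   (5.10)
> First assume `x ≤ t₀^{1.02}`. We may write
> `exp{s₀w − 𝓛₂²w² − 2πix(e^w − 1)} = exp{2πi(t₀ − x)w − 𝓛₂²w²} f*(x,w)`
> with `f*(x,w) = exp{(1/2)w − 2πix(e^w − 1 − w)}`. …
> If `w ∈ L₁ ∪ L₅`, then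
> `exp{2πi(t₀−x)w − 𝓛₂²w²}(f*(x,w) − 1) ≪ exp{−𝓛₂²u²}(1 + e^{u/2})`. …
> By simple estimates, `∫_{L_j} |exp{2πi(t₀−x)w − 𝓛₂²w²} dw| ≪ ω(1/2+2πix) + ε` if `j = 2,3,4`.
> Since `t₀^{3.06}/𝓛₂⁴ ≪ α`, we have `f*(x,w) − 1 ≪ |w| + x|w|² ≪ α` for `w ∈ L₂ ∪ L₃ ∪ L₄`. …
> Now assume `x > t₀^{1.02}`. … We have
> `Re{s₀w − 𝓛₂²w² − 2πix(e^w − 1)} = ½u − 𝓛₂²(u² − v²) + 2πv(xe^u sin v/v − t₀)`.   (5.13)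
> If `w ∈ L′₁`, then the right side of (5.13) is `≤ ½u − (10^{−2}𝓛₂ log x)²`. …
> For `w ∈ L′₂ ∪ L′₃` we have `xe^u ≥ x^{0.99} > 2t₀` and `−1/𝓛₂ ≤ v ≤ 0`, so that
> `2π(xe^u sin v/v − t₀) > x^{0.99}`.
> If `w ∈ L′₂`, then `(𝓛₂u)² = (10^{−2}𝓛₂ log x)²`, so the right side of (5.13) is
> `≤ −(10^{−2}𝓛₂ log x)² + O(1)`. … If `w ∈ L′₃`, then `v = −1/𝓛₂`, and the right side of (5.13)
> is `< 1 + ½u − (𝓛₂u)² − x^{0.99}/𝓛₂`.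

This file PROVES (all EXACT or with explicit constants; `Real.sinc v = sin v/v`, `= 1` at `v = 0`):

* `Lemma53.cexp_phase_eq_mul_fstar` — the factorisation through `f*`;
* `Lemma53.norm_fstar_ofReal` (`|f*(x,u)| = e^{u/2}` for real `u`) and
  `Lemma53.norm_lin_mul_fstar_sub_one_le` — the `L₁ ∪ L₅` display with constant `1`;
* `Lemma53.norm_fstar_sub_one_le` — `|f*(x,w) − 1| ≤ |w| + 4π|x||w|²` once `|w| ≤ 1`,
  `4π|x||w|² ≤ 1` (the display "`f* − 1 ≪ |w| + x|w|²`");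
* `Lemma53.norm_cexp_lin_saddle` / `norm_cexp_lin_vertical_le` — the "simple estimates" behind
  `∫_{L_j}|…| ≪ ω(1/2+2πix) + ε`: on the horizontal line `Im w = v* = π(t₀−x)/𝓛₂²` the modulus is
  EXACTLY `e^{−𝓛₂²u²}·e^{−(π(t₀−x)/𝓛₂)²}` (whose `u`-integral over `ℝ` is `ω(1/2+2πix)`,
  `SmoothWeight.integral_omegaLine` of `Section2SmoothWeight`), and on the vertical segments
  between `Im w = 0` and `Im w = v*` it is `≤ e^{−𝓛₂²u²}`;
* `Lemma53.re_phase_eq` — **(5.13) EXACT** (for all `v`, with `sinc`), `re_phase_eq_of_ne_zero` —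
  as printed (`v ≠ 0`);
* `Lemma53.five_sixths_lt_sinc` and `Lemma53.lt_two_pi_mul_sub` — the step
  "`xe^u ≥ X > 2t₀`, `|v| ≤ 1` ⇒ `2π(xe^u sin v/v − t₀) > X`" (`X` for the printed `x^{0.99}`);
* `Lemma53.re_phase_le_L1'`, `re_phase_le_L2'`, `re_phase_lt_L3'` — the three right-side bounds
  for `L′₁, L′₂, L′₃` (general `c ≥ 0` for the printed `10^{−2}`; the `O(1)` of `L′₂` is `1`);
* `Lemma53.integrable_cexp_phase` — the integrand of (5.10) is absolutely integrable
  (`|exp{phase}(u)| = e^{u/2 − 𝓛₂²u²}`), so `Delta510 := ∫ exp{phase}` is a Bochner integral.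

NOT reproduced: the derivation of (5.10) from (5.6)–(5.7) by the Mellin transform ([1, Lemma 2]
of the source = Balasubramanian–Conrey–Heath-Brown 1985), the applications of Cauchy's theorem,
and the final `≪`-assembly of (5.8)/(5.9) with the manuscript's parameter values. Nothing about
Theorems 1–2 of the source is stated or implied; nothing here bears on the cell's verdict on (8.24).

## References

* Y. Zhang, arXiv:2211.02515v1 (2022), §5 pp. 10–11, Lemma 5.3 and its proof, (5.10)–(5.13).
  [cite: Zhang2022LandauSiegel, §5 Lemma 5.3 (proof), (5.10)–(5.13)]
-/

noncomputable section

open Complex Real Set MeasureTheory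

namespace Literature.NumberTheory.LFunctions.Zhang2022

namespace Lemma53

/-- The phase of (5.10): `s₀w − 𝓛₂²w² − 2πix(e^w − 1)`, `s₀ = 1/2 + 2πit₀`.
[cite: Zhang2022LandauSiegel, §5 (5.10)] -/
def phase (L₂ t₀ x : ℝ) (w : ℂ) : ℂ :=
  (1 / 2 + 2 * π * t₀ * I) * w - (L₂ : ℂ) ^ 2 * w ^ 2 - 2 * π * I * x * (cexp w - 1)

/-- The Gaussian-linear part `2πi(t₀ − x)w − 𝓛₂²w²`.
[cite: Zhang2022LandauSiegel, §5 Lemma 5.3 (proof)] -/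
def lin (L₂ t₀ x : ℝ) (w : ℂ) : ℂ := 2 * π * I * (t₀ - x) * w - (L₂ : ℂ) ^ 2 * w ^ 2

/-- `f*(x,w) = exp{(1/2)w − 2πix(e^w − 1 − w)}`. [cite: Zhang2022LandauSiegel, §5 Lemma 5.3 (proof)] -/
def fstar (x : ℝ) (w : ℂ) : ℂ := cexp (w / 2 - 2 * π * I * x * (cexp w - 1 - w))

/-- (5.10) read as a definition: `Δ(x) = ∫_{−∞}^{∞} exp{s₀u − 𝓛₂²u² − 2πix(e^u − 1)} du`
(the manuscript defines `Δ` by (5.6)–(5.7) and derives (5.10) from [1, Lemma 2]; that derivation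
is not reproduced here). [cite: Zhang2022LandauSiegel, §5 (5.10)] -/
def Delta510 (L₂ t₀ x : ℝ) : ℂ := ∫ u : ℝ, cexp (phase L₂ t₀ x u)

/-- Unfolding lemma for `phase`. [cite: Zhang2022LandauSiegel, §5 (5.10)] -/
lemma phase_def (L₂ t₀ x : ℝ) (w : ℂ) : phase L₂ t₀ x w
    = (1 / 2 + 2 * π * t₀ * I) * w - (L₂ : ℂ) ^ 2 * w ^ 2 - 2 * π * I * x * (cexp w - 1) := rfl

/-- Unfolding lemma for `lin`. [cite: Zhang2022LandauSiegel, §5 Lemma 5.3 (proof)] -/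
lemma lin_def (L₂ t₀ x : ℝ) (w : ℂ) :
    lin L₂ t₀ x w = 2 * π * I * (t₀ - x) * w - (L₂ : ℂ) ^ 2 * w ^ 2 := rfl

/-- Unfolding lemma for `fstar`. [cite: Zhang2022LandauSiegel, §5 Lemma 5.3 (proof)] -/
lemma fstar_def (x : ℝ) (w : ℂ) :
    fstar x w = cexp (w / 2 - 2 * π * I * x * (cexp w - 1 - w)) := rfl

/-! ## The factorisation through `f*` (case `x ≤ t₀^{1.02}`) -/

/-- **"We may write `exp{s₀w − 𝓛₂²w² − 2πix(e^w−1)} = exp{2πi(t₀−x)w − 𝓛₂²w²} f*(x,w)`"**, EXACT.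
[cite: Zhang2022LandauSiegel, §5 Lemma 5.3 (proof)] -/
theorem cexp_phase_eq_mul_fstar (L₂ t₀ x : ℝ) (w : ℂ) :
    cexp (phase L₂ t₀ x w) = cexp (lin L₂ t₀ x w) * fstar x w := by
  rw [fstar_def, ← Complex.exp_add, phase_def, lin_def]
  congr 1
  ring

/-- For real `u`: `|exp{2πi(t₀−x)u − 𝓛₂²u²}| = e^{−𝓛₂²u²}`. [folklore] -/
theorem norm_cexp_lin_ofReal (L₂ t₀ x u : ℝ) :
    ‖cexp (lin L₂ t₀ x u)‖ = Real.exp (-(L₂ ^ 2 * u ^ 2)) := by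
  rw [Complex.norm_exp, lin_def]
  congr 1
  simp [Complex.mul_re, Complex.sub_re, pow_two]

/-- For real `u`: `|f*(x,u)| = e^{u/2}` (the factor `2πix(e^u − 1 − u)` is purely imaginary).
[cite: Zhang2022LandauSiegel, §5 Lemma 5.3 (proof)] -/
theorem norm_fstar_ofReal (x u : ℝ) : ‖fstar x u‖ = Real.exp (u / 2) := by
  rw [fstar_def, Complex.norm_exp]
  congr 1
  have h : (u : ℂ) / 2 - 2 * π * I * x * (cexp u - 1 - u)
      = ((u / 2 : ℝ) : ℂ) + ((-(2 * π * x * (Real.exp u - 1 - u)) : ℝ) : ℂ) * I := by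
    push_cast
    ring
  rw [h, Complex.add_re, ofReal_re, re_ofReal_mul, Complex.I_re, mul_zero, add_zero]

/-- **"If `w ∈ L₁ ∪ L₅`, then `exp{2πi(t₀−x)w − 𝓛₂²w²}(f*(x,w) − 1) ≪ exp{−𝓛₂²u²}(1 + e^{u/2})`"**
— for every real `w = u`, with constant `1`. [cite: Zhang2022LandauSiegel, §5 Lemma 5.3 (proof)] -/
theorem norm_lin_mul_fstar_sub_one_le (L₂ t₀ x u : ℝ) :
    ‖cexp (lin L₂ t₀ x u) * (fstar x u - 1)‖
      ≤ Real.exp (-(L₂ ^ 2 * u ^ 2)) * (1 + Real.exp (u / 2)) := by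
  rw [norm_mul, norm_cexp_lin_ofReal]
  gcongr
  calc ‖fstar x u - 1‖ ≤ ‖fstar x (u : ℂ)‖ + ‖(1 : ℂ)‖ := norm_sub_le _ _
    _ = 1 + Real.exp (u / 2) := by rw [norm_fstar_ofReal, norm_one, add_comm]

/-- **"`f*(x,w) − 1 ≪ |w| + x|w|²`"** with explicit constants: if `|w| ≤ 1` and `4π|x||w|² ≤ 1`
then `|f*(x,w) − 1| ≤ |w| + 4π|x||w|²`. [cite: Zhang2022LandauSiegel, §5 Lemma 5.3 (proof)] -/
theorem norm_fstar_sub_one_le {x : ℝ} {w : ℂ} (hw : ‖w‖ ≤ 1) (hxw : 4 * π * |x| * ‖w‖ ^ 2 ≤ 1) :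
    ‖fstar x w - 1‖ ≤ ‖w‖ + 4 * π * |x| * ‖w‖ ^ 2 := by
  have h1 : ‖cexp w - 1 - w‖ ≤ ‖w‖ ^ 2 := Complex.norm_exp_sub_one_sub_id_le hw
  have h2 : ‖w / 2 - 2 * π * I * x * (cexp w - 1 - w)‖ ≤ ‖w‖ / 2 + 2 * π * |x| * ‖w‖ ^ 2 := by
    calc ‖w / 2 - 2 * π * I * x * (cexp w - 1 - w)‖
        ≤ ‖w / 2‖ + ‖2 * π * I * x * (cexp w - 1 - w)‖ := norm_sub_le _ _
      _ = ‖w‖ / 2 + 2 * π * |x| * ‖cexp w - 1 - w‖ := by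
          simp [Complex.norm_real, Real.norm_eq_abs, abs_of_pos pi_pos]
      _ ≤ ‖w‖ / 2 + 2 * π * |x| * ‖w‖ ^ 2 := by gcongr
  have h3 : ‖w / 2 - 2 * π * I * x * (cexp w - 1 - w)‖ ≤ 1 := by
    have : ‖w‖ / 2 + 2 * π * |x| * ‖w‖ ^ 2 ≤ 1 := by nlinarith [norm_nonneg w]
    exact h2.trans this
  rw [fstar_def]
  calc ‖cexp (w / 2 - 2 * π * I * x * (cexp w - 1 - w)) - 1‖
      ≤ 2 * ‖w / 2 - 2 * π * I * x * (cexp w - 1 - w)‖ := Complex.norm_exp_sub_one_le h3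
    _ ≤ 2 * (‖w‖ / 2 + 2 * π * |x| * ‖w‖ ^ 2) := by gcongr
    _ = ‖w‖ + 4 * π * |x| * ‖w‖ ^ 2 := by ring

/-! ## The "simple estimates" on `L₂, L₃, L₄` (saddle contour `Im w = v* = π(t₀ − x)/𝓛₂²`) -/

/-- The modulus of `exp{2πi(t₀−x)w − 𝓛₂²w²}` at `w = u + iv`:
`exp{−2π(t₀−x)v − 𝓛₂²(u² − v²)}`. [folklore] -/
theorem norm_cexp_lin (L₂ t₀ x u v : ℝ) :
    ‖cexp (lin L₂ t₀ x (u + v * I))‖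
      = Real.exp (-(2 * π * (t₀ - x) * v) - L₂ ^ 2 * (u ^ 2 - v ^ 2)) := by
  rw [Complex.norm_exp, lin_def]
  congr 1
  have : ((2 : ℂ) * π * I * (t₀ - x) * (u + v * I) - (L₂ : ℂ) ^ 2 * (u + v * I) ^ 2)
      = ((-(2 * π * (t₀ - x) * v) - L₂ ^ 2 * (u ^ 2 - v ^ 2) : ℝ) : ℂ)
        + ((2 * π * (t₀ - x) * u - 2 * L₂ ^ 2 * u * v : ℝ) : ℂ) * I := by
    push_cast
    ring_nf
    rw [I_sq]
    ring
  rw [this, Complex.add_re, ofReal_re, re_ofReal_mul, Complex.I_re, mul_zero, add_zero]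

/-- **On `L₃`** (the horizontal line `Im w = v* = π(t₀−x)/𝓛₂²`) the modulus is EXACTLY the
Gaussian `e^{−𝓛₂²u²}·e^{−(π(t₀−x)/𝓛₂)²}`; its `u`-integral over `ℝ` is `ω(1/2+2πix)`
(`SmoothWeight.integral_omegaLine`). [cite: Zhang2022LandauSiegel, §5 Lemma 5.3 (proof)] -/
theorem norm_cexp_lin_saddle {L₂ : ℝ} (hL : L₂ ≠ 0) (t₀ x u : ℝ) :
    ‖cexp (lin L₂ t₀ x (u + (π * (t₀ - x) / L₂ ^ 2 : ℝ) * I))‖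
      = Real.exp (-(L₂ ^ 2 * u ^ 2)) * Real.exp (-(π * (t₀ - x) / L₂) ^ 2) := by
  rw [norm_cexp_lin, ← Real.exp_add]
  congr 1
  field_simp
  ring

/-- **On `L₂`, `L₄`** (the vertical segments from `Im w = 0` to `Im w = v* = π(t₀−x)/𝓛₂²`): for
every `v` with `(v − v*)² ≤ v*²` (i.e. `v` between `0` and `2v*`, which contains those segments)
the modulus is `≤ e^{−𝓛₂²u²}`. [cite: Zhang2022LandauSiegel, §5 Lemma 5.3 (proof)] -/
theorem norm_cexp_lin_vertical_le {L₂ : ℝ} (hL : L₂ ≠ 0) (t₀ x u : ℝ) {v : ℝ}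
    (hv : (v - π * (t₀ - x) / L₂ ^ 2) ^ 2 ≤ (π * (t₀ - x) / L₂ ^ 2) ^ 2) :
    ‖cexp (lin L₂ t₀ x (u + v * I))‖ ≤ Real.exp (-(L₂ ^ 2 * u ^ 2)) := by
  rw [norm_cexp_lin]
  apply Real.exp_le_exp.mpr
  have hL2 : 0 < L₂ ^ 2 := by positivity
  have key : -(2 * π * (t₀ - x) * v) - L₂ ^ 2 * (u ^ 2 - v ^ 2)
      = -(L₂ ^ 2 * u ^ 2)
        + L₂ ^ 2 * ((v - π * (t₀ - x) / L₂ ^ 2) ^ 2 - (π * (t₀ - x) / L₂ ^ 2) ^ 2) := by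
    field_simp
    ring
  rw [key]
  nlinarith [mul_nonpos_of_nonneg_of_nonpos hL2.le (sub_nonpos.mpr hv)]

/-! ## (5.13) and the case `x > t₀^{1.02}` -/

/-- **(5.13)**, EXACT, for every `w = u + iv` (with `Real.sinc v = sin v / v`, `= 1` at `v = 0`):
`Re{s₀w − 𝓛₂²w² − 2πix(e^w − 1)} = ½u − 𝓛₂²(u² − v²) + 2πv(xe^u sinc v − t₀)`.
[cite: Zhang2022LandauSiegel, §5 (5.13)] -/
theorem re_phase_eq (L₂ t₀ x u v : ℝ) :
    (phase L₂ t₀ x (u + v * I)).re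
      = u / 2 - L₂ ^ 2 * (u ^ 2 - v ^ 2) + 2 * π * v * (x * Real.exp u * Real.sinc v - t₀) := by
  have hsinc : v * Real.sinc v = Real.sin v := by
    by_cases hv : v = 0
    · simp [hv]
    · rw [Real.sinc_of_ne_zero hv]; field_simp
  have hexp : cexp (u + v * I) = ((Real.exp u * Real.cos v : ℝ) : ℂ)
      + ((Real.exp u * Real.sin v : ℝ) : ℂ) * I := by
    rw [Complex.exp_add, ← ofReal_exp, Complex.exp_mul_I]
    push_cast
    rw [← Complex.ofReal_cos, ← Complex.ofReal_sin]
    ring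
  rw [phase_def, hexp]
  have : ((1 / 2 + 2 * π * t₀ * I) * (u + v * I) - (L₂ : ℂ) ^ 2 * (u + v * I) ^ 2
      - 2 * π * I * x * ((((Real.exp u * Real.cos v : ℝ) : ℂ)
        + ((Real.exp u * Real.sin v : ℝ) : ℂ) * I) - 1))
      = ((u / 2 - 2 * π * t₀ * v - L₂ ^ 2 * (u ^ 2 - v ^ 2)
          + 2 * π * x * (Real.exp u * Real.sin v) : ℝ) : ℂ)
        + ((v / 2 + 2 * π * t₀ * u - 2 * L₂ ^ 2 * u * v
          - 2 * π * x * (Real.exp u * Real.cos v - 1) : ℝ) : ℂ) * I := by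
    push_cast
    ring_nf
    rw [I_sq]
    ring
  rw [this, Complex.add_re, ofReal_re, re_ofReal_mul, Complex.I_re, mul_zero, add_zero]
  rw [show 2 * π * v * (x * Real.exp u * Real.sinc v - t₀)
      = 2 * π * x * (Real.exp u * (v * Real.sinc v)) - 2 * π * t₀ * v by ring, hsinc]
  ring

/-- (5.13) as printed, for `v ≠ 0`:
`Re{…} = ½u − 𝓛₂²(u² − v²) + 2πv(xe^u sin v/v − t₀)`. [cite: Zhang2022LandauSiegel, §5 (5.13)] -/
theorem re_phase_eq_of_ne_zero (L₂ t₀ x u : ℝ) {v : ℝ} (hv : v ≠ 0) :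
    (phase L₂ t₀ x (u + v * I)).re
      = u / 2 - L₂ ^ 2 * (u ^ 2 - v ^ 2) + 2 * π * v * (x * Real.exp u * Real.sin v / v - t₀) := by
  rw [re_phase_eq, Real.sinc_of_ne_zero hv]
  ring

/-- (5.13) on the real axis (`v = 0`): `Re{…}(u) = ½u − 𝓛₂²u²`; hence
`|exp{phase}(u)| = e^{u/2 − 𝓛₂²u²}`. [cite: Zhang2022LandauSiegel, §5 (5.13)] -/
theorem re_phase_ofReal (L₂ t₀ x u : ℝ) : (phase L₂ t₀ x u).re = u / 2 - L₂ ^ 2 * u ^ 2 := by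
  have h := re_phase_eq L₂ t₀ x u 0
  simp only [ofReal_zero, zero_mul, add_zero] at h
  rw [h]
  ring

/-- `sin v / v > 5/6` for `0 < |v| ≤ 1` (and `sinc 0 = 1`): from Mathlib's `x − x³/6 < sin x`.
[folklore] -/
theorem five_sixths_lt_sinc {v : ℝ} (hv : |v| ≤ 1) : 5 / 6 < Real.sinc v := by
  wlog hpos : 0 ≤ v generalizing v
  · have h := this (v := -v) (by rwa [abs_neg]) (by linarith)
    rwa [Real.sinc_neg] at h
  rcases eq_or_lt_of_le hpos with h0 | hvpos
  · rw [← h0, Real.sinc_zero]; norm_num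
  · rw [Real.sinc_of_ne_zero hvpos.ne', lt_div_iff₀ hvpos]
    have h1 := Real.sin_gt_sub_cube hvpos
    have hv1 : v ≤ 1 := (le_abs_self v).trans hv
    nlinarith [pow_le_one₀ hpos hv1 (n := 2), sq_nonneg v]

/-- **"`xe^u ≥ x^{0.99} > 2t₀` and `−1/𝓛₂ ≤ v ≤ 0`, so that `2π(xe^u sin v/v − t₀) > x^{0.99}`"**:
for `0 < X ≤ xe^u`, `2t₀ < X`, `|v| ≤ 1`: `X < 2π(xe^u·sinc v − t₀)`.
[cite: Zhang2022LandauSiegel, §5 Lemma 5.3 (proof)] -/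
theorem lt_two_pi_mul_sub {x u v t₀ X : ℝ} (hX : 0 < X) (hXle : X ≤ x * Real.exp u)
    (ht : 2 * t₀ < X) (hv : |v| ≤ 1) :
    X < 2 * π * (x * Real.exp u * Real.sinc v - t₀) := by
  have hs := five_sixths_lt_sinc hv
  have hxe : 0 ≤ x * Real.exp u := hX.le.trans hXle
  have h1 : 5 / 6 * X ≤ x * Real.exp u * Real.sinc v := by
    calc 5 / 6 * X ≤ 5 / 6 * (x * Real.exp u) := by gcongr
      _ ≤ x * Real.exp u * Real.sinc v := by nlinarith
  have hπ : 3 < π := Real.pi_gt_three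
  nlinarith

/-- **`L′₁`**: for `v = 0` and `u ≤ −c·log x ≤ 0` the right side of (5.13) is
`≤ ½u − (c𝓛₂ log x)²` (printed with `c = 10^{−2}`). [cite: Zhang2022LandauSiegel, §5 Lemma 5.3 (proof)] -/
theorem re_phase_le_L1' (L₂ t₀ x : ℝ) {c u : ℝ} (hc : 0 ≤ c * Real.log x)
    (hu : u ≤ -(c * Real.log x)) :
    (phase L₂ t₀ x u).re ≤ u / 2 - (c * L₂ * Real.log x) ^ 2 := by
  rw [re_phase_ofReal]
  have h1 : (c * Real.log x) ^ 2 ≤ u ^ 2 := by nlinarith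
  nlinarith [sq_nonneg L₂]

/-- **`L′₂`**: for `u = −c·log x` (`c·log x ≥ 0`), `−1/𝓛₂ ≤ v ≤ 0`, `𝓛₂ ≥ 1`, and
`xe^u ≥ X > 2t₀`, `X > 0`: the right side of (5.13) is `≤ −(c𝓛₂ log x)² + 1`
(the printed `O(1)` is `1`). [cite: Zhang2022LandauSiegel, §5 Lemma 5.3 (proof)] -/
theorem re_phase_le_L2' {L₂ : ℝ} (hL : 1 ≤ L₂) (t₀ x : ℝ) {c v X : ℝ} (hc : 0 ≤ c * Real.log x)
    (hv1 : -(1 / L₂) ≤ v) (hv0 : v ≤ 0) (hX : 0 < X) (hXle : X ≤ x * Real.exp (-(c * Real.log x)))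
    (ht : 2 * t₀ < X) :
    (phase L₂ t₀ x ((-(c * Real.log x) : ℝ) + v * I)).re ≤ -(c * L₂ * Real.log x) ^ 2 + 1 := by
  have hL0 : 0 < L₂ := by linarith
  have hvabs : |v| ≤ 1 := by
    rw [abs_of_nonpos hv0]
    have : 1 / L₂ ≤ 1 := (div_le_one hL0).mpr hL
    linarith
  have hkey := lt_two_pi_mul_sub hX hXle ht hvabs
  rw [re_phase_eq]
  have h1 : L₂ ^ 2 * v ^ 2 ≤ 1 := by
    have hvl : |v| * L₂ ≤ 1 := by
      rw [abs_of_nonpos hv0]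
      have := mul_le_mul_of_nonneg_right hv1 hL0.le
      rw [show -(1 / L₂) * L₂ = -1 by field_simp] at this
      linarith
    have h0 : 0 ≤ |v| * L₂ := mul_nonneg (abs_nonneg v) hL0.le
    calc L₂ ^ 2 * v ^ 2 = (|v| * L₂) ^ 2 := by rw [mul_pow, sq_abs]; ring
      _ ≤ 1 := pow_le_one₀ h0 hvl
  have h2 : 2 * π * v * (x * Real.exp (-(c * Real.log x)) * Real.sinc v - t₀) ≤ 0 := by
    have : 0 < 2 * π * (x * Real.exp (-(c * Real.log x)) * Real.sinc v - t₀) := hX.trans hkey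
    nlinarith
  nlinarith

/-- **`L′₃`**: for `v = −1/𝓛₂`, `𝓛₂ ≥ 1`, and `xe^u ≥ X > 2t₀`, `X > 0`: the right side of (5.13)
is `< 1 + ½u − (𝓛₂u)² − X/𝓛₂`. [cite: Zhang2022LandauSiegel, §5 Lemma 5.3 (proof)] -/
theorem re_phase_lt_L3' {L₂ : ℝ} (hL : 1 ≤ L₂) (t₀ x u : ℝ) {X : ℝ} (hX : 0 < X)
    (hXle : X ≤ x * Real.exp u) (ht : 2 * t₀ < X) :
    (phase L₂ t₀ x (u + (-(1 / L₂) : ℝ) * I)).re < 1 + u / 2 - (L₂ * u) ^ 2 - X / L₂ := by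
  have hL0 : 0 < L₂ := by linarith
  have hvabs : |(-(1 / L₂) : ℝ)| ≤ 1 := by
    rw [abs_neg, abs_of_pos (one_div_pos.mpr hL0)]
    exact (div_le_one hL0).mpr hL
  have hkey := lt_two_pi_mul_sub hX hXle ht hvabs
  rw [re_phase_eq]
  have h1 : L₂ ^ 2 * (u ^ 2 - (-(1 / L₂)) ^ 2) = (L₂ * u) ^ 2 - 1 := by
    rw [neg_sq, mul_sub, one_div, inv_pow, mul_inv_cancel₀ (pow_ne_zero 2 hL0.ne')]
    ring
  rw [h1]
  have h2 : 2 * π * (-(1 / L₂)) * (x * Real.exp u * Real.sinc (-(1 / L₂)) - t₀) < -(X / L₂) := by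
    have : 2 * π * (-(1 / L₂)) * (x * Real.exp u * Real.sinc (-(1 / L₂)) - t₀)
        = -((2 * π * (x * Real.exp u * Real.sinc (-(1 / L₂)) - t₀)) / L₂) := by ring
    rw [this, neg_lt_neg_iff]
    exact div_lt_div_of_pos_right hkey hL0
  linarith

/-! ## Absolute convergence of (5.10) -/

/-- `|exp{phase}(u)| = e^{u/2 − 𝓛₂²u²}` for real `u`. [cite: Zhang2022LandauSiegel, §5 (5.10)] -/
theorem norm_cexp_phase_ofReal (L₂ t₀ x u : ℝ) :
    ‖cexp (phase L₂ t₀ x u)‖ = Real.exp (u / 2 - L₂ ^ 2 * u ^ 2) := by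
  rw [Complex.norm_exp, re_phase_ofReal]

/-- The integrand of (5.10) is integrable on `ℝ` when `𝓛₂ ≠ 0`. [folklore] -/
theorem integrable_cexp_phase {L₂ : ℝ} (hL : L₂ ≠ 0) (t₀ x : ℝ) :
    Integrable fun u : ℝ => cexp (phase L₂ t₀ x u) := by
  have hb : (-(L₂ : ℂ) ^ 2).re < 0 := by
    have : (-(L₂ : ℂ) ^ 2) = ((-(L₂ ^ 2) : ℝ) : ℂ) := by push_cast; ring
    rw [this, ofReal_re]
    have : 0 < L₂ ^ 2 := by positivity
    linarith
  have hg : Integrable fun u : ℝ => cexp (-(L₂ : ℂ) ^ 2 * (u : ℂ) ^ 2 + (1 / 2) * u + 0) :=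
    integrable_cexp_quadratic' hb _ _
  have hc : Continuous fun u : ℝ => cexp (phase L₂ t₀ x u) := by
    unfold phase
    fun_prop
  refine hg.norm.mono' hc.aestronglyMeasurable (Filter.Eventually.of_forall fun u => ?_)
  rw [norm_cexp_phase_ofReal, Complex.norm_exp]
  apply le_of_eq
  congr 1
  have : (-(L₂ : ℂ) ^ 2 * (u : ℂ) ^ 2 + 1 / 2 * u + 0) = ((u / 2 - L₂ ^ 2 * u ^ 2 : ℝ) : ℂ) := by
    push_cast; ring
  rw [this, ofReal_re]

end Lemma53

end Literature.NumberTheory.LFunctions.Zhang2022
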